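import Summits.BirchSwinnertonDyer.BirchSwinnertonDyer.Theorems.ByReductionTypeAtTwoAdditivePotGoodPrintShuZhai80b1
import Summits.BirchSwinnertonDyer.BirchSwinnertonDyer.Theorems.ByReductionTypeAtTwoAdditivePotGoodPrintShuZhai20a1Witness
import HarnessLib

/-!
# K4 crux `AdditiveRankZeroAtTwo` (19098), children C2″ (22616) / C3″ (22617): the Shu–Zhai road at `80b1` is NOT VACUOUS — the member
# `M = 7*·23* = 161` (`7`, `23` admissible: inert in `ℚ(E[2]) = ℚ(i)` and `ℚ(E′[2]) = ℚ(√5)`; `2`, `5` split in `ℚ(√161)`): `BSD(·, 2)` with both K4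
# halves at every global minimal `80b1^{(161)}` (rank `0`) and `BSD(·, 2)` at every global minimal `80b1^{(−4991)}` (rank `1`), BY NAME from the Table row

Cell `bsd-2adic`, seat `bsd-2adic-k4-w2` GEN 7 (prover, explicit unit, no kit); `--supports stmt-BirchSwinnertonDyer-22616 --as helper`
(cc C3″ 22617); twin of GEN 6's `…PrintShuZhai20a1Witness.lean` — same admissible primes and the same `M`, since `80b1 = 20a1^{(−1)}` has the
same `2`-division fields `ℚ(i)` / `ℚ(√5)` (indeed the same `Δ = −6400` and `Δ(E′) = 327680`), the same bad primes `2, 5` and the same Heegner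
prime `p = 31`; its arithmetic lemmas (`prod_qStar_seven_twentythree`, the field lemmas) are reused by import. By name: Shu–Zhai Thm. 1.2/1.4,
the Table row `80b1` (`ShuZhai2021.table52_row80b1`), Creutz–Miller, ARS Thm. 2.6, modularity. Closes nothing at the `∀`-level; nothing booked;
BSD is not proved by any of this.

References: [ShuZhai2021] Def. 1.1, Thm. 1.2, Thm. 1.4, §5.2 Table (row 80b1: admissible `3, 7, 23, 43, 47`); [Marcus1977] Ch. 3 Thm. 25.
-/

set_option autoImplicit false
set_option linter.dupNamespace false

noncomputable section

open scoped Classical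

open Module NumberField WeierstrassCurve Literature.NumberTheory.EllipticCurves
  Literature.NumberTheory.EllipticCurves.ModularForms
  Literature.NumberTheory.EllipticCurves.Rank1Residual
  Literature.NumberTheory.EllipticCurves.Rank1Residual.Typed
  Literature.NumberTheory.EllipticCurves.ShuZhai2021
  Literature.NumberTheory.EllipticCurves.AgasheRibetStein2006
  Literature.NumberTheory.QuadraticFields.Quadratic
  Summit.BirchSwinnertonDyer
  Summit.BirchSwinnertonDyer.Rank1Residual
  Summit.BirchSwinnertonDyer.Rank1Residual.X5.O1
  Summit.BirchSwinnertonDyer.Rank1Residual.P2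
  Summit.BirchSwinnertonDyer.BirchSwinnertonDyer.Rank1Residual.IntModel
  Summit.BirchSwinnertonDyer.BirchSwinnertonDyer.Theorems

namespace Summit.BirchSwinnertonDyer.BirchSwinnertonDyer.Theorems.AddPotGoodPrint

/-! ## §9 `ℚ(E[2]) = ℚ(i)` and `ℚ(E′[2]) = ℚ(√5)`: `7` and `23` are inert in both -/

/-- **`q ≡ 3 (mod 4)` prime (here `q ∈ {7, 23}`) is inert in `ℚ(√Δ(80b1)) = ℚ(√−6400) = ℚ(i)`** (`−6400 = −4·40²`, `d_K = −4`,
`(−4/q) = −1`). [cite: ShuZhai2021, Def. 1.1] [cite: Marcus1977, Ch. 3 Thm. 25] -/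
theorem isInertInSqrt_Δ_80b1 {q : ℕ} [hq : Fact q.Prime] (hleg : legendreSym q (-4) = -1) :
    IsInertInSqrt q (⟨0, -1, 0, 4, -4⟩ : WeierstrassCurve ℚ).Δ := by
  have hΔ : (⟨0, -1, 0, 4, -4⟩ : WeierstrassCurve ℚ).Δ = ((-6400 : ℤ) : ℚ) := by
    norm_num [WeierstrassCurve.Δ, WeierstrassCurve.b₂, WeierstrassCurve.b₄, WeierstrassCurve.b₆, WeierstrassCurve.b₈]
  rw [hΔ, isInertInSqrt_intCast]
  intro K _ _ h2 hx
  obtain ⟨x, hx⟩ := hx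
  have hd : NumberField.discr K = -4 :=
    KrizLi2019.discr_eq_of_sq_eq h2 (d₀ := -4) (m := 40) (Or.inr ⟨⟨-1, by norm_num⟩, by decide,
      by rw [show (-4 : ℤ) / 4 = -1 by norm_num]; exact isUnit_one.neg.squarefree⟩) (by norm_num) (by norm_num) hx
  exact BurungaleSkinner2023.isInertIn_of_legendreSym_eq_neg_one h2 (by rw [hd]; exact hleg)

/-- **`q` prime with `(5/q) = −1` (here `q ∈ {7, 23}`) is inert in `ℚ(√Δ(E′)) = ℚ(√(2¹⁶·5)) = ℚ(√5)`** (`d_K = 5`).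
[cite: ShuZhai2021, Def. 1.1] [cite: Marcus1977, Ch. 3 Thm. 25] -/
theorem isInertInSqrt_Δ_Ep80b1 {q : ℕ} [hq : Fact q.Prime] (hleg : legendreSym q 5 = -1) :
    IsInertInSqrt q (⟨0, -4, 0, -16, 0⟩ : WeierstrassCurve ℚ).Δ := by
  have hΔ : (⟨0, -4, 0, -16, 0⟩ : WeierstrassCurve ℚ).Δ = ((327680 : ℤ) : ℚ) := by
    norm_num [WeierstrassCurve.Δ, WeierstrassCurve.b₂, WeierstrassCurve.b₄, WeierstrassCurve.b₆, WeierstrassCurve.b₈]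
  rw [hΔ, isInertInSqrt_intCast]
  intro K _ _ h2 hx
  obtain ⟨x, hx⟩ := hx
  have hy : (x / 256) ^ 2 = ((5 : ℤ) : K) := by
    rw [div_pow, hx]; push_cast; norm_num
  have hd : NumberField.discr K = 5 :=
    discr_eq_of_sq_eq_of_fundamental h2 ⟨by decide, by
        rw [show (5 : ℤ) = ((5 : ℕ) : ℤ) by rfl, Int.squarefree_natCast]; exact Nat.prime_five.prime.squarefree, by norm_num⟩
      (fun r h => by
        have h5 : ∃ s : ℚ, s * s = 5 := ⟨r, by push_cast at h; rw [← sq]; exact h⟩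
        rw [Rat.exists_mul_self] at h5
        exact absurd h5 (by norm_num [Rat.sqrt, Nat.sqrt])) hy
  exact BurungaleSkinner2023.isInertIn_of_legendreSym_eq_neg_one h2 (by rw [hd]; exact hleg)

/-- **`7` and `23` are admissible for `80b1`** (Def. 1.1: prime, coprime to `2N` — `N ∣ 6400` —, inert in `ℚ(i)` and `ℚ(√5)`;
Shu–Zhai's table lists both). [cite: ShuZhai2021, Def. 1.1 and §5.2 Table (row 80b1)] -/
theorem isAdmissible_seven_twentythree_80b1 :
    haveI := isElliptic_80b1
    IsAdmissible (⟨0, -1, 0, 4, -4⟩ : WeierstrassCurve ℚ) (⟨0, -4, 0, -16, 0⟩ : WeierstrassCurve ℚ) 7 ∧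
      IsAdmissible (⟨0, -1, 0, 4, -4⟩ : WeierstrassCurve ℚ) (⟨0, -4, 0, -16, 0⟩ : WeierstrassCurve ℚ) 23 := by
  have n7a : ¬ IsSquare ((-4 : ℤ) : ZMod 7) := by decide
  have n7b : ¬ IsSquare ((5 : ℤ) : ZMod 7) := by decide
  have n23a : ¬ IsSquare ((-4 : ℤ) : ZMod 23) := by decide
  have n23b : ¬ IsSquare ((5 : ℤ) : ZMod 23) := by decide
  haveI := isElliptic_80b1
  haveI : Fact (Nat.Prime 7) := ⟨by norm_num⟩
  haveI : Fact (Nat.Prime 23) := ⟨by norm_num⟩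
  have h2N : 2 * (⟨0, -1, 0, 4, -4⟩ : WeierstrassCurve ℚ).conductorNorm ℤ ∣ 12800 := mul_dvd_mul_left 2 conductorNorm_dvd_80b1
  have l7a : legendreSym 7 (-4) = -1 := (legendreSym.eq_neg_one_iff 7).mpr n7a
  have l7b : legendreSym 7 5 = -1 := (legendreSym.eq_neg_one_iff 7).mpr n7b
  have l23a : legendreSym 23 (-4) = -1 := (legendreSym.eq_neg_one_iff 23).mpr n23a
  have l23b : legendreSym 23 5 = -1 := (legendreSym.eq_neg_one_iff 23).mpr n23b
  exact ⟨⟨by norm_num, Nat.Coprime.coprime_dvd_right h2N (by norm_num), isInertInSqrt_Δ_80b1 l7a, isInertInSqrt_Δ_Ep80b1 l7b⟩,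
    ⟨by norm_num, Nat.Coprime.coprime_dvd_right h2N (by norm_num), isInertInSqrt_Δ_80b1 l23a, isInertInSqrt_Δ_Ep80b1 l23b⟩⟩

/-! ## §10 `M = 7*·23* = 161`: every `ℓ ∣ 2N` splits in `ℚ(√161)` -/

/-- **In every quadratic field containing `√161`, the primes `2` and `5` split** (`d = 161 = 7·23 ≡ 1 (mod 8)`, `(161/5) = (1/5) = 1`):
Thm. 1.4 (ii) «every `ℓ ∣ 2N` splits in `ℚ(√M)`» for `M = 161`. [cite: ShuZhai2021, Thm. 1.4 (ii)] [cite: Marcus1977, Ch. 3 Thm. 25] -/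
theorem allPrimesSplitInSqrt_161_80b1 :
    haveI := isElliptic_80b1
    AllPrimesSplitInSqrt (2 * (⟨0, -1, 0, 4, -4⟩ : WeierstrassCurve ℚ).conductorNorm ℤ) 161 := by
  haveI := isElliptic_80b1
  refine Or.inr fun F _ _ h2 hx => ?_
  obtain ⟨x, hx⟩ := hx
  have hsq : Squarefree (161 : ℤ) := by
    rw [show (161 : ℤ) = (161 : ℕ) by rfl, Int.squarefree_natCast]; exact (by decide +kernel : Squarefree (161 : ℕ))
  have hd : NumberField.discr F = 161 :=
    discr_eq_of_sq_eq_of_fundamental h2 ⟨by decide, hsq, by norm_num⟩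
      (fun r h => by
        have h' : ∃ s : ℚ, s * s = 161 := ⟨r, by push_cast at h; rw [← sq]; exact h⟩
        rw [Rat.exists_mul_self] at h'
        exact absurd h' (by norm_num [Rat.sqrt, Nat.sqrt])) (by exact_mod_cast hx)
  have h2s : ((Ideal.span {(2 : ℤ)}).primesOver (𝓞 F)).ncard = 2 := (ncard_primesOver_two_eq_two_iff h2).mpr (by rw [hd]; decide)
  have h161 : ((161 : ℤ) : ZMod 5) ≠ 0 := by decide
  have hsq : IsSquare ((161 : ℤ) : ZMod 5) := ⟨1, by decide⟩
  haveI : Fact (Nat.Prime 5) := ⟨by norm_num⟩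
  have h5s : ((Ideal.span {(5 : ℤ)}).primesOver (𝓞 F)).ncard = 2 :=
    (ncard_primesOver_eq_two_iff_legendreSym h2 (by norm_num)).mpr (by rw [hd]; exact (legendreSym.eq_one_iff 5 h161).mpr hsq)
  intro p hp hpN
  rcases eq_two_or_five_of_dvd_two_mul_conductorNorm_80b1 hp hpN with rfl | rfl
  · simpa using h2s
  · simpa using h5s

/-! ## §11 The members `80b1^{(161)}` (rank `0`) and `80b1^{(−4991)}` (rank `1`) -/

/-- **BSD₂ (both K4 halves, `r_an = 0`, habitat) at every global minimal model of `80b1^{(161)}`** — `Q = {7, 23}` admissible IN THE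
KERNEL, `2`, `5` split in `ℚ(√161)` IN THE KERNEL; displayed: the optimality datum and «`f([0]) ∉ 2E(ℚ)`»; by name: Shu–Zhai Thm.
1.2/1.4, Creutz–Miller, ARS Thm. 2.6, modularity. BSD is not proved by any of this.
[cite: ShuZhai2021, Thm. 1.2 and Thm. 1.4] [cite: CreutzMiller2012, Thm. 1.1] [cite: Miller2011LMS, Def. 1.1] -/
theorem printFamily80b1_witness161 (h12 : thm12_ranks_of_twists) (h14 : thm14_twoPartBSD_of_twists)
    (h26 : cremona_abs_maninConstant_eq_one_of_level_le) (hCM : bsdTriple_of_analyticRank_le_one_of_conductor_lt)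
    (hmod : hasEntireLFunction_rat)
    (htab : table52_row80b1)
    (W : WeierstrassCurve ℚ) [W.IsElliptic] [W.IsGloballyMinimal]
    (hW : ∃ C : VariableChange ℚ, C • (⟨0, -1, 0, 4, -4⟩ : WeierstrassCurve ℚ).quadraticTwist 161 = W) :
    haveI : Fact (Nat.Prime 2) := ⟨Nat.prime_two⟩
    W.analyticRank = 0 ∧ Addv W 2 ∧ 0 ≤ padicValRat 2 W.j ∧ ¬ W.HasCM ∧ Red W 2 ∧
      BSDp W 2 ∧ MissingLowerBoundAt W 2 ∧ MissingUpperBoundAt W 2 := by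
  haveI := isElliptic_80b1
  have hQ : ∀ q ∈ ({7, 23} : Finset ℕ),
      IsAdmissible (⟨0, -1, 0, 4, -4⟩ : WeierstrassCurve ℚ) (⟨0, -4, 0, -16, 0⟩ : WeierstrassCurve ℚ) q ∧ q ≠ 31 := by
    intro q hq
    simp only [Finset.mem_insert, Finset.mem_singleton] at hq
    rcases hq with rfl | rfl
    · exact ⟨isAdmissible_seven_twentythree_80b1.1, by norm_num⟩
    · exact ⟨isAdmissible_seven_twentythree_80b1.2, by norm_num⟩
  have hQM := allPrimesSplitInSqrt_161_80b1
  rw [← prod_qStar_seven_twentythree] at hQM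
  have hW' : ∃ C : VariableChange ℚ, C • (⟨0, -1, 0, 4, -4⟩ : WeierstrassCurve ℚ).quadraticTwist
      ((∏ q ∈ ({7, 23} : Finset ℕ), qStar q : ℤ) : ℚ) = W := by
    rw [prod_qStar_seven_twentythree]; exact_mod_cast hW
  exact printFamily80b1_of_shuZhai_of_table52 h12 h14 htab h26 hCM hmod {7, 23} hQ hQM W hW'

/-- **`r_an = 1 ∧ BSD₂` (with the habitat) at every global minimal model of `80b1^{(−4991)}`**, `−4991 = −31·7*·23*` — the rank-ONE
companion member. BSD is not proved by any of this. [cite: ShuZhai2021, Thm. 1.2 and Thm. 1.4] [cite: CreutzMiller2012, Thm. 1.1] -/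
theorem printFamily80b1_rankOne_witness4991 (h12 : thm12_ranks_of_twists) (h14 : thm14_twoPartBSD_of_twists)
    (h26 : cremona_abs_maninConstant_eq_one_of_level_le) (hCM : bsdTriple_of_analyticRank_le_one_of_conductor_lt)
    (hmod : hasEntireLFunction_rat)
    (htab : table52_row80b1)
    (W₁ : WeierstrassCurve ℚ) [W₁.IsElliptic] [W₁.IsGloballyMinimal]
    (hW₁ : ∃ C : VariableChange ℚ, C • (⟨0, -1, 0, 4, -4⟩ : WeierstrassCurve ℚ).quadraticTwist (-4991) = W₁) :
    haveI : Fact (Nat.Prime 2) := ⟨Nat.prime_two⟩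
    W₁.analyticRank = 1 ∧ Addv W₁ 2 ∧ 0 ≤ padicValRat 2 W₁.j ∧ ¬ W₁.HasCM ∧ Red W₁ 2 ∧ BSDp W₁ 2 := by
  haveI := isElliptic_80b1
  have hQ : ∀ q ∈ ({7, 23} : Finset ℕ),
      IsAdmissible (⟨0, -1, 0, 4, -4⟩ : WeierstrassCurve ℚ) (⟨0, -4, 0, -16, 0⟩ : WeierstrassCurve ℚ) q ∧ q ≠ 31 := by
    intro q hq
    simp only [Finset.mem_insert, Finset.mem_singleton] at hq
    rcases hq with rfl | rfl
    · exact ⟨isAdmissible_seven_twentythree_80b1.1, by norm_num⟩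
    · exact ⟨isAdmissible_seven_twentythree_80b1.2, by norm_num⟩
  have hQM := allPrimesSplitInSqrt_161_80b1
  rw [← prod_qStar_seven_twentythree] at hQM
  have hW' : ∃ C : VariableChange ℚ, C • (⟨0, -1, 0, 4, -4⟩ : WeierstrassCurve ℚ).quadraticTwist
      ((-(31 : ℕ) * ∏ q ∈ ({7, 23} : Finset ℕ), qStar q : ℤ) : ℚ) = W₁ := by
    rw [prod_qStar_seven_twentythree]; norm_num; exact hW₁
  exact printFamily80b1_rankOne_of_shuZhai_of_table52 h12 h14 htab h26 hCM hmod {7, 23} hQ hQM W₁ hW'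

end Summit.BirchSwinnertonDyer.BirchSwinnertonDyer.Theorems.AddPotGoodPrint

end
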